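import Mathlib
import Summits.ValiantsHypothesis.ValiantsHypothesis.Theorems.LacunarySymmetroidMatrixDescartesDefiniteMomentsDescartes

/-!
# `MatrixDescartes` (stmt-ValiantsHypothesis-18050) — the DEFINITE-MOMENTS LAW, VIII: sharpness at `(m, K) = (2, 3)`

HONEST FRAMING.  Cell `pub-symmetroid`, seat `val-sym-mdr-p2` (gen 14); helper file `--supports` the crux
`Theses.LacunarySymmetroid.MatrixDescartes`, NO closure claim.  A kernel CALIBRATION of the definite-moments law
(`…DefiniteMomentsDescartes.card_posRoots_le_of_alternatingMoments`: K alternating definite scales ⇒ `Z₊ ≤ (K−1)·m`): the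
bound is ATTAINED at `(m, K) = (2, 3)` by the diagonal word `F(x) = diag((x−1)(x−4), (x−2)(x−5)) = S₀ + x S₁ + x² S₂`,
`S₀ = diag(4,10) ≻ 0`, `S₁ = diag(−5,−7) ≺ 0`, `S₂ = 1 ≻ 0`, which is positive definite at `x = 1/2`, negative definite at
`x = 3`, positive definite at `x = 6`, and whose determinant has exactly the four positive zeros `1, 2, 4, 5 = (K−1)·m`
(`sharp_two_three`; the law's upper bound for this very pencil is re-derived alongside).  Block-diagonal copies and
interlaced diagonal K-nomials give `(K−1)·m` at every format (not filed).  Nothing here bears on the crux, on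
`DoorA26`/`DoorA34`, registers, or `VP ≠ VNP`.  [folklore]; axioms standard; no definitions.
-/

-- layout Summits/ValiantsHypothesis/ValiantsHypothesis forces the duplicated namespace component
set_option linter.dupNamespace false

namespace Summit.ValiantsHypothesis.ValiantsHypothesis.Theorems.LacunarySymmetroidMatrixDescartes

open Polynomial Matrix Finset
open scoped BigOperators

namespace DefiniteMoments

/-- The evaluated pencil of the sharpness example is `diag(x² − 5x + 4, x² − 7x + 10)`. [folklore] -/
theorem sharp_eval_eq (x : ℝ) :
    (∑ l : Fin 3, x ^ (![0, 1, 2] : Fin 3 → ℕ) l •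
        (![Matrix.diagonal ![4, 10], Matrix.diagonal ![-5, -7], Matrix.diagonal ![1, 1]] :
          Fin 3 → Matrix (Fin 2) (Fin 2) ℝ) l)
      = Matrix.diagonal ![x ^ 2 - 5 * x + 4, x ^ 2 - 7 * x + 10] := by
  ext i j
  simp only [Fin.sum_univ_three, Matrix.add_apply, Matrix.smul_apply, Matrix.diagonal_apply, smul_eq_mul]
  fin_cases i <;> fin_cases j <;> simp <;> ring

/-- Its Rayleigh form. [folklore] -/
theorem sharp_form_eq (x : ℝ) (v : Fin 2 → ℝ) :
    v ⬝ᵥ ((∑ l : Fin 3, x ^ (![0, 1, 2] : Fin 3 → ℕ) l •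
        (![Matrix.diagonal ![4, 10], Matrix.diagonal ![-5, -7], Matrix.diagonal ![1, 1]] :
          Fin 3 → Matrix (Fin 2) (Fin 2) ℝ) l) *ᵥ v)
      = (x ^ 2 - 5 * x + 4) * v 0 ^ 2 + (x ^ 2 - 7 * x + 10) * v 1 ^ 2 := by
  rw [sharp_eval_eq]
  simp [dotProduct, Matrix.mulVec_diagonal, Fin.sum_univ_two]
  ring

/-- The determinant of the sharpness pencil is `(X−1)(X−4)·(X−2)(X−5)`. [folklore] -/
theorem sharp_det_eq :
    Matrix.det (∑ l : Fin 3, ((X : ℝ[X]) ^ (![0, 1, 2] : Fin 3 → ℕ) l) •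
        ((![Matrix.diagonal ![4, 10], Matrix.diagonal ![-5, -7], Matrix.diagonal ![1, 1]] :
          Fin 3 → Matrix (Fin 2) (Fin 2) ℝ) l).map C)
      = (X - C 1) * (X - C 4) * ((X - C 2) * (X - C 5)) := by
  have h : (∑ l : Fin 3, ((X : ℝ[X]) ^ (![0, 1, 2] : Fin 3 → ℕ) l) •
        ((![Matrix.diagonal ![4, 10], Matrix.diagonal ![-5, -7], Matrix.diagonal ![1, 1]] :
          Fin 3 → Matrix (Fin 2) (Fin 2) ℝ) l).map C)
      = Matrix.diagonal ![X ^ 2 - C 5 * X + C 4, X ^ 2 - C 7 * X + C 10] := by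
    ext i j
    simp only [Fin.sum_univ_three, Matrix.add_apply, Matrix.smul_apply, Matrix.map_apply, Matrix.diagonal_apply,
      smul_eq_mul]
    fin_cases i <;> fin_cases j <;> simp [map_neg] <;> ring
  rw [h, Matrix.det_diagonal, Fin.prod_univ_two]
  simp only [Matrix.cons_val_zero, Matrix.cons_val_one]
  simp only [map_ofNat, map_one]
  ring

/-- **Sharpness of the definite-moments law at `(2, 3)`**: the three-term `2 × 2` pencil
`diag(4,10) + X·diag(−5,−7) + X²·1` is definite with alternating signs at the scales `1/2 < 3 < 6`, so the law gives
`Z₊ ≤ (K−1)·m = 4`; and its determinant `(X−1)(X−2)(X−4)(X−5)` has EXACTLY `4` distinct positive zeros. [folklore] -/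
theorem sharp_two_three :
    (∀ (j : Fin 3) (v : Fin 2 → ℝ), v ≠ 0 →
      0 < (1 : ℝ) * (-1) ^ (j : ℕ) * (v ⬝ᵥ ((∑ l : Fin 3, (![1 / 2, 3, 6] : Fin 3 → ℝ) j ^ (![0, 1, 2] : Fin 3 → ℕ) l •
        (![Matrix.diagonal ![4, 10], Matrix.diagonal ![-5, -7], Matrix.diagonal ![1, 1]] :
          Fin 3 → Matrix (Fin 2) (Fin 2) ℝ) l) *ᵥ v))) ∧
    ((Matrix.det (∑ l : Fin 3, ((X : ℝ[X]) ^ (![0, 1, 2] : Fin 3 → ℕ) l) •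
        ((![Matrix.diagonal ![4, 10], Matrix.diagonal ![-5, -7], Matrix.diagonal ![1, 1]] :
          Fin 3 → Matrix (Fin 2) (Fin 2) ℝ) l).map C)).roots.toFinset.filter (fun t => 0 < t)).card ≤ 2 * 2 ∧
    ((Matrix.det (∑ l : Fin 3, ((X : ℝ[X]) ^ (![0, 1, 2] : Fin 3 → ℕ) l) •
        ((![Matrix.diagonal ![4, 10], Matrix.diagonal ![-5, -7], Matrix.diagonal ![1, 1]] :
          Fin 3 → Matrix (Fin 2) (Fin 2) ℝ) l).map C)).roots.toFinset.filter (fun t => 0 < t)).card = 4 := by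
  have hsymm : ∀ l, ((![Matrix.diagonal ![4, 10], Matrix.diagonal ![-5, -7], Matrix.diagonal ![1, 1]] :
      Fin 3 → Matrix (Fin 2) (Fin 2) ℝ) l).IsSymm := by
    intro l
    fin_cases l <;> simp [Matrix.IsSymm, Matrix.diagonal_transpose]
  have hmono : StrictMono (![1 / 2, 3, 6] : Fin 3 → ℝ) := by
    refine Fin.strictMono_iff_lt_succ.2 fun i => ?_
    fin_cases i <;> simp <;> norm_num
  have halt : ∀ (j : Fin 3) (v : Fin 2 → ℝ), v ≠ 0 →
      0 < (1 : ℝ) * (-1) ^ (j : ℕ) * (v ⬝ᵥ ((∑ l : Fin 3, (![1 / 2, 3, 6] : Fin 3 → ℝ) j ^ (![0, 1, 2] : Fin 3 → ℕ) l •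
        (![Matrix.diagonal ![4, 10], Matrix.diagonal ![-5, -7], Matrix.diagonal ![1, 1]] :
          Fin 3 → Matrix (Fin 2) (Fin 2) ℝ) l) *ᵥ v)) := by
    intro j v hv
    have hpos : 0 < v 0 ^ 2 + v 1 ^ 2 := by
      by_contra h
      push Not at h
      have h0 : v 0 = 0 := by nlinarith [sq_nonneg (v 0), sq_nonneg (v 1)]
      have h1 : v 1 = 0 := by nlinarith [sq_nonneg (v 0), sq_nonneg (v 1)]
      exact hv (funext fun i => by fin_cases i <;> assumption)
    rw [sharp_form_eq]
    fin_cases j <;> simp <;> nlinarith [sq_nonneg (v 0), sq_nonneg (v 1), hpos]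
  refine ⟨halt, ?_, ?_⟩
  · have h := card_posRoots_le_of_alternatingMoments (![0, 1, 2] : Fin 3 → ℕ)
      (![Matrix.diagonal ![4, 10], Matrix.diagonal ![-5, -7], Matrix.diagonal ![1, 1]] :
        Fin 3 → Matrix (Fin 2) (Fin 2) ℝ) hsymm 2 (by simp) (![1 / 2, 3, 6]) hmono (by simp) 1 halt
    simpa using h
  · rw [sharp_det_eq]
    have h12 : (X - C (1 : ℝ)) * (X - C 4) ≠ 0 := mul_ne_zero (X_sub_C_ne_zero _) (X_sub_C_ne_zero _)
    have h45 : (X - C (2 : ℝ)) * (X - C 5) ≠ 0 := mul_ne_zero (X_sub_C_ne_zero _) (X_sub_C_ne_zero _)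
    rw [Polynomial.roots_mul (mul_ne_zero h12 h45), Polynomial.roots_mul h12, Polynomial.roots_mul h45,
      Polynomial.roots_X_sub_C, Polynomial.roots_X_sub_C, Polynomial.roots_X_sub_C, Polynomial.roots_X_sub_C]
    simp only [Multiset.toFinset_add, Multiset.toFinset_singleton, Finset.filter_union,
      Finset.filter_singleton]
    norm_num

end DefiniteMoments

end Summit.ValiantsHypothesis.ValiantsHypothesis.Theorems.LacunarySymmetroidMatrixDescartes
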